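import Summits.ValiantsHypothesis.ValiantsHypothesis.Theorems.LacunarySymmetroidMatrixDescartesDoorA26ClosureChamberBridge

/-!
# `DoorA26` — REAL-EXPONENT TWENTIES AVOID THE OPEN CONES OF CERTIFIED CHAMBERS

HONEST FRAMING.  Object-search cell `pub-symmetroid`, door-A target `DoorA26 := PosRootLawAt 2 6 19`
(stmt-ValiantsHypothesis-19979; OPEN, typed, never asserted).  Seat val-sym-door-p2 g16 (#6).  Corollaries of the census → closure bridge
(`…DoorA26ClosureChamberBridge`, #1) in the SEQUENCE currency of the W-line's chain statements (`s3111`, `NoTightChain26NC`, …: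
`δs ν`, symmetric `U ν`, twenty strictly increasing log-zeros `z ν`); decides nothing about the door.

* `mem_twentyLocus_of_twenty_log_zeros` — EXIT LEMMA (converse of the tree's entrance `twenty_log_zeros_of_mem_twentyLocus`): symmetric
  letters whose exponential pencil `t ↦ det Σ e^{δ_l t} S_l` is not identically zero and vanishes at twenty distinct reals put `δ` in the
  twenty-locus (the zero set is finite by Laguerre, `expSum_zero_or_ncard_le`, so twenty distinct zeros give `ncard ≥ 20`; `x = e^t`).
* `not_strictMono_pairSum_of_twenty` / `…_of_twenty_chamber` — A REAL-EXPONENT TWENTY NEVER LIES IN THE OPEN CONE OF A CERTIFIED CHAMBER: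
  with a kernel row for the order `σ` (`∀ d, StrictMono (pairSum d ∘ σ) → PosRootLawOn 2 6 19 d`), no `δ ∈ ℝ⁶` carrying such a twenty has
  its pair sums strictly increasing along `σ`.  For the W-line: along any sequence of twenties `δs ν → δ₀`, every `δs ν` lies in an
  UNcertified open cone or on a wall; at a stratum component with exactly one uncertified refining chamber the approach side is forced
  (located list: memo `CLOSURE-CENSUS-g16.md`, e.g. the bottom-triple component at reduced order (0,4,6,9): chambers {1672 open, 2569 certified}).

`DoorA26`, (W), (M), (R), `TripleStratum26`, `MatrixDescartes` (stmt-ValiantsHypothesis-18050) OPEN; registers unchanged; nothing on `VP ≠ VNP`.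
`--supports stmt-ValiantsHypothesis-19979 --as helper`.

[folklore] Laguerre's finiteness for real exponential sums (tree `expSum_zero_or_ncard_le`); no further citation needed.
-/

-- `Summit.ValiantsHypothesis.ValiantsHypothesis.…` repeats a component by the D-0017 layout
-- (single-conjunct summit), which the `dupNamespace` linter flags; the name is mandated.
set_option linter.dupNamespace false

namespace Summit.ValiantsHypothesis.ValiantsHypothesis.Theorems.LacunarySymmetroidMatrixDescartes.Census.RealExp

open Finset
open scoped BigOperators Matrix
open Summit.ValiantsHypothesis.ValiantsHypothesis.Theorems.LacunarySymmetroidMatrixDescartes.WallBubbling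

/-- **Exit lemma.**  Twenty distinct real zeros of a not-identically-zero symmetric exponential pencil put its exponent vector in the
twenty-locus (census spelling). [this work] -/
theorem mem_twentyLocus_of_twenty_log_zeros (δ : Fin 6 → ℝ) (S : Fin 6 → Matrix (Fin 2) (Fin 2) ℝ) (hS : ∀ l, (S l).IsSymm)
    (hne : ∃ t, (∑ l, Real.exp (δ l * t) • S l).det ≠ 0)
    (z : Fin 20 → ℝ) (hz : Function.Injective z) (hroot : ∀ j, (∑ l, Real.exp (δ l * z j) • S l).det = 0) :
    δ ∈ {δ' : Fin 6 → ℝ | ∃ S' : Fin 6 → Matrix (Fin 2) (Fin 2) ℝ, (∀ l, (S' l).IsSymm) ∧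
      20 ≤ {x : ℝ | 0 < x ∧ (∑ l, (x ^ (δ' l)) • S' l).det = 0}.ncard} := by
  classical
  refine ⟨S, hS, ?_⟩
  rw [ncard_rpow_eq_ncard_exp δ S]
  -- Leibniz: the determinant is a real exponential sum, whose zero set is finite unless it vanishes identically
  set α : Equiv.Perm (Fin 2) × (Fin 2 → Fin 6) → ℝ :=
    fun p => ((Equiv.Perm.sign p.1 : ℤ) : ℝ) * ∏ i, S (p.2 i) (p.1 i) i with hα
  set s : Equiv.Perm (Fin 2) × (Fin 2 → Fin 6) → ℝ := fun p => ∑ i, δ (p.2 i) with hs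
  have hsum : ∀ t, (∑ l, Real.exp (δ l * t) • S l).det = ∑ p, α p * Real.exp (s p * t) :=
    fun t => det_expPencil_eq_expSum δ S t
  have hZ : {t : ℝ | (∑ l, Real.exp (δ l * t) • S l).det = 0} = {t | ∑ p, α p * Real.exp (s p * t) = 0} := by
    ext t; rw [Set.mem_setOf_eq, Set.mem_setOf_eq, hsum]
  have hfin : {t : ℝ | (∑ l, Real.exp (δ l * t) • S l).det = 0}.Finite := by
    rcases expSum_zero_or_ncard_le α s with h | h
    · obtain ⟨t, ht⟩ := hne
      exact absurd (by rw [hsum]; exact h t) ht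
    · rw [hZ]; exact h.1
  have hsub : Set.range z ⊆ {t : ℝ | (∑ l, Real.exp (δ l * t) • S l).det = 0} := by
    rintro t ⟨j, rfl⟩; exact hroot j
  calc 20 = (Set.range z).ncard := by
          rw [Set.ncard_range_of_injective hz, Nat.card_eq_fintype_card, Fintype.card_fin]
    _ ≤ _ := Set.ncard_le_ncard hsub hfin

/-- **Exit lemma, W-line spelling** (`Bubbling.TwentyLocus`). [this work] -/
theorem mem_bubblingTwentyLocus_of_twenty_log_zeros (δ : Fin 6 → ℝ) (S : Fin 6 → Matrix (Fin 2) (Fin 2) ℝ)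
    (hS : ∀ l, (S l).IsSymm) (hne : ∃ t, (∑ l, Real.exp (δ l * t) • S l).det ≠ 0)
    (z : Fin 20 → ℝ) (hz : Function.Injective z) (hroot : ∀ j, (∑ l, Real.exp (δ l * z j) • S l).det = 0) :
    δ ∈ Bubbling.TwentyLocus :=
  mem_twentyLocus_of_twenty_log_zeros δ S hS hne z hz hroot

/-- **A real-exponent twenty never lies in the open cone of a certified chamber.**  If the integer row of the order `σ` holds, then no
`δ ∈ ℝ⁶` whose pair sums increase strictly along `σ` carries symmetric letters with a not-identically-zero exponential pencil vanishing
at twenty distinct reals. [this work] -/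
theorem not_strictMono_pairSum_of_twenty (δ : Fin 6 → ℝ) (σ : Fin 21 → Fin 6 × Fin 6)
    (hrow : ∀ d : Fin 6 → ℕ, StrictMono ((fun p : Fin 6 × Fin 6 => d p.1 + d p.2) ∘ σ) → PosRootLawOn 2 6 19 d)
    (S : Fin 6 → Matrix (Fin 2) (Fin 2) ℝ) (hS : ∀ l, (S l).IsSymm) (hne : ∃ t, (∑ l, Real.exp (δ l * t) • S l).det ≠ 0)
    (z : Fin 20 → ℝ) (hz : Function.Injective z) (hroot : ∀ j, (∑ l, Real.exp (δ l * z j) • S l).det = 0) :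
    ¬ StrictMono ((fun p : Fin 6 × Fin 6 => δ p.1 + δ p.2) ∘ σ) := fun hδ =>
  not_mem_closure_twentyLocus_of_chamberRow δ σ hδ hrow
    (subset_closure (mem_twentyLocus_of_twenty_log_zeros δ S hS hne z hz hroot))

/-- **By chamber id** (`hrow` := a landed `doorA26_on_chamber<n>`): twenties of the W-line's sequences `δs ν` never enter the open cone of
the certified chamber `n` — they approach a stratum point through uncertified cones or walls only. [this work] -/
theorem not_strictMono_pairSum_of_twenty_chamber (δ : Fin 6 → ℝ) (n : ℕ)
    (hrow : ∀ d : Fin 6 → ℕ, StrictMono ((fun p : Fin 6 × Fin 6 => d p.1 + d p.2) ∘ chamber n) → PosRootLawOn 2 6 19 d)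
    (S : Fin 6 → Matrix (Fin 2) (Fin 2) ℝ) (hS : ∀ l, (S l).IsSymm) (hne : ∃ t, (∑ l, Real.exp (δ l * t) • S l).det ≠ 0)
    (z : Fin 20 → ℝ) (hz : Function.Injective z) (hroot : ∀ j, (∑ l, Real.exp (δ l * z j) • S l).det = 0) :
    ¬ StrictMono ((fun p : Fin 6 × Fin 6 => δ p.1 + δ p.2) ∘ chamber n) :=
  not_strictMono_pairSum_of_twenty δ (chamber n) hrow S hS hne z hz hroot

/-- **Sequence form** (the binders of the W-line's chain statements): along a sequence of twenties, NO term lies in the open cone of a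
certified chamber. [this work] -/
theorem chain_avoids_certified_chamber (n : ℕ)
    (hrow : ∀ d : Fin 6 → ℕ, StrictMono ((fun p : Fin 6 × Fin 6 => d p.1 + d p.2) ∘ chamber n) → PosRootLawOn 2 6 19 d)
    (δs : ℕ → Fin 6 → ℝ) (U : ℕ → Fin 6 → Matrix (Fin 2) (Fin 2) ℝ) (hU : ∀ ν l, (U ν l).IsSymm)
    (hne : ∀ ν, ∃ t, (∑ l, Real.exp (δs ν l * t) • U ν l).det ≠ 0)
    (z : ℕ → Fin 20 → ℝ) (hz : ∀ ν, StrictMono (z ν)) (hroot : ∀ ν i, (∑ l, Real.exp (δs ν l * z ν i) • U ν l).det = 0) :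
    ∀ ν, ¬ StrictMono ((fun p : Fin 6 × Fin 6 => δs ν p.1 + δs ν p.2) ∘ chamber n) := fun ν =>
  not_strictMono_pairSum_of_twenty_chamber (δs ν) n hrow (U ν) (hU ν) (hne ν) (z ν) (hz ν).injective (hroot ν)

end Summit.ValiantsHypothesis.ValiantsHypothesis.Theorems.LacunarySymmetroidMatrixDescartes.Census.RealExp
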